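import Literature.NumberTheory.NumberFields.CyclicCubicField103
import Literature.NumberTheory.NumberFields.CubicRing
import Mathlib.NumberTheory.NumberField.ClassNumber
import HarnessLib

/-!
# The cyclic cubic field of conductor `103`: discriminant `103²`, class number one, primes above `2, 3, 5, 13`, residue maps

Second file on `K = ℚ(θ)`, `θ³ + θ² - 34θ - 61 = 0` (`CyclicCubicField103.lean`: integral basis
`1, θ, ω = (θ² - 1)/3`, units, `Gal(K/ℚ) = ⟨σ⟩`, units modulo squares), supplying the arithmetic for
the explicit `2`-descent of `480a1` over `K` (the conductor-`103` cubic subfield of the field `F₃`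
of Dokchitser–Dokchitser 2011, proof of Thm. 2). It follows `CyclicCubicField13Primes.lean`; the new
points are that `𝓞 K ≠ ℤ[θ]` (index `3`) and that `3` splits. Everything is PROVED:

* **Ring homomorphisms out of `𝓞 K` by images of `θ, ω`** (`ringHomOfImages`): a pair `t, w ∈ S`
  satisfying the three relations of the integral basis (`θ² = 1 + 3ω`, `θω = 20 + 11θ - ω`,
  `ω² = -3 + 3θ + 11ω`) defines `𝓞 K →+* S` (coordinates are unique, `coords_unique`); this gives
  all residue and reduction maps (`ψ` to `ℤ/3` at the three primes above `3`, to
  `CubicRing (ℤ/8) 61 34 (-1) = ℤ[θ]/8 = 𝓞 K/8` with `ω ↦ 3(t² - 1)`).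
* **Dedekind–Kummer away from `3`**: `3 ∈ 𝔣_θ` (conductor), so `p ∤ exponent(θ)` for primes `p ≠ 3`
  and Mathlib's `primesOverSpanEquivMonicFactorsMod` applies: `eq_span_of_no_root` — the primes
  `2, 5, 7, 11, 17, 19` are inert (`f` has no root mod `p`).
* **`d_K = 10609 = 103²`** (`discr_eq`): from the explicit `ℤ`-basis `1, θ, ω` of `𝓞 K` (`intBasis`)
  and `disc(1, θ, θ²) = 95481` by the change of basis of determinant `1/3`.
* **Class number one** (`instIsPrincipalIdealRing`): Minkowski bound `⌊M_K⌋ ≤ 22`; the primes above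
  `p ≤ 22` are `(p)` for the inert `p`, and above `3` and `13` they are principal:
  `3 = -(θ + 2)(9 - ω)(ω - θ - 6)`, `13 = -(6 - θ)(ω - 1)(14 + θ - ω)` with factors of norm `∓3`, `∓13`.
* The primes above `3`: `𝔮₁ = (θ + 2)`, `𝔮₂ = (9 - ω)`, `𝔮₃ = (ω - θ - 6)`, each of norm `3`, with
  residue maps `ψ : 𝓞 K → ℤ/3` of kernel `𝔮ᵢ` (`exists_residueMap_three`); every prime above `3` is
  one of them (`eq_of_mem_primesOver_three`).

## References

* D. A. Marcus, *Number Fields*, 2nd ed. (2018), Ch. 3, Thm. 27 (Dedekind–Kummer); Ch. 5, Cor. 2 of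
  Thm. 37 (Minkowski bound). [cite: Marcus2018, Ch. 5, Thm. 37]
* T. Dokchitser, V. Dokchitser, J. Number Theory 131 (2011) 1833–1839, proof of Thm. 2.
  [DokchitserDokchitser2011RankModN]
-/

noncomputable section

open Polynomial NumberField Algebra Ideal

namespace Literature.NumberTheory.NumberFields

namespace CyclicCubic103

/-! ### Uniqueness of coordinates on `1, θ, ω`; ring homomorphisms by images of `θ, ω` -/

/-- Coordinates on `1, θ, ω` are unique (`1, θ, θ²` is a `ℚ`-basis and `ω = (θ² - 1)/3`).
[folklore] -/
theorem coords_unique {a b c a' b' c' : ℤ}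
    (h : (a : K) + (b : K) * θ + (c : K) * ω = (a' : K) + (b' : K) * θ + (c' : K) * ω) :
    a = a' ∧ b = b' ∧ c = c' := by
  have hq : (((c - c') / 3 : ℚ) : K) * θ ^ 2 + (((b - b') : ℚ) : K) * θ +
      (((a - a') - (c - c') / 3 : ℚ) : K) = 0 := by
    rw [show ω = (θ ^ 2 - 1) / 3 from rfl] at h
    push_cast
    linear_combination h
  by_contra hne
  refine quadratic_ne_zero ?_ hq
  intro h0
  simp only [Prod.mk.injEq] at h0
  obtain ⟨h1, h2, h3⟩ := h0
  apply hne
  have hc : (c : ℚ) = c' := by linarith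
  have hb : (b : ℚ) = b' := by linarith
  have ha : (a : ℚ) = a' := by rw [hc, sub_self, zero_div, sub_zero] at h3; linarith
  exact ⟨by exact_mod_cast ha, by exact_mod_cast hb, by exact_mod_cast hc⟩

/-- The coordinate vector of `z ∈ 𝓞 K` on the integral basis `1, θ, ω`. [folklore] -/
def coord (z : 𝓞 K) : ℤ × ℤ × ℤ :=
  (Classical.choose (exists_int_coords z), Classical.choose (Classical.choose_spec (exists_int_coords z)),
    Classical.choose (Classical.choose_spec (Classical.choose_spec (exists_int_coords z))))

/-- `z = coord₀ + coord₁ θ + coord₂ ω`. [folklore] -/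
theorem coord_spec (z : 𝓞 K) : z = (coord z).1 + (coord z).2.1 * θint + (coord z).2.2 * ωint :=
  Classical.choose_spec (Classical.choose_spec (Classical.choose_spec (exists_int_coords z)))

/-- The coordinates of `a + bθ + cω` are `(a, b, c)`. [folklore] -/
theorem coord_eq_of_eq {z : 𝓞 K} {a b c : ℤ} (h : z = a + b * θint + c * ωint) : coord z = (a, b, c) := by
  subst h
  have h1 := coord_spec ((a : 𝓞 K) + b * θint + c * ωint)
  have h2 := congrArg (fun x : 𝓞 K => (x : K)) h1
  simp only [map_add, map_mul, map_intCast, coe_θint, coe_ωint] at h2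
  obtain ⟨ha, hb, hc⟩ := coords_unique h2
  exact Prod.ext ha.symm (Prod.ext hb.symm hc.symm)

/-- **The product on coordinates** (from `θ² = 1 + 3ω`, `θω = 20 + 11θ - ω`, `ω² = -3 + 3θ + 11ω`).
[folklore] -/
theorem mul_coords (a b c a' b' c' : ℤ) :
    ((a : 𝓞 K) + b * θint + c * ωint) * (a' + b' * θint + c' * ωint) =
      ((a * a' + b * b' + 20 * (b * c' + c * b') - 3 * (c * c') : ℤ) : 𝓞 K) +
      ((a * b' + b * a' + 11 * (b * c' + c * b') + 3 * (c * c') : ℤ) : 𝓞 K) * θint +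
      ((a * c' + c * a' + 3 * (b * b') - (b * c' + c * b') + 11 * (c * c') : ℤ) : 𝓞 K) * ωint := by
  obtain ⟨h1, h2, h3⟩ := int_basis_rel
  push_cast
  linear_combination (b * b' : 𝓞 K) * h1 + ((b : 𝓞 K) * c' + c * b') * h2 + (c * c' : 𝓞 K) * h3

/-- **Ring homomorphisms `𝓞 K → S` by images of `θ` and `ω`.** Given `t, w ∈ S` satisfying the
relations of the integral basis, `a + bθ + cω ↦ a + bt + cw` is a ring homomorphism. [folklore] -/
def ringHomOfImages {S : Type*} [CommRing S] (t w : S) (h1 : t ^ 2 = 1 + 3 * w)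
    (h2 : t * w = 20 + 11 * t - w) (h3 : w ^ 2 = -3 + 3 * t + 11 * w) : 𝓞 K →+* S where
  toFun z := (coord z).1 + (coord z).2.1 * t + (coord z).2.2 * w
  map_one' := by
    rw [coord_eq_of_eq (z := 1) (a := 1) (b := 0) (c := 0) (by push_cast; ring)]
    push_cast; ring
  map_zero' := by
    rw [coord_eq_of_eq (z := 0) (a := 0) (b := 0) (c := 0) (by push_cast; ring)]
    push_cast; ring
  map_add' z z' := by
    have hz := coord_spec z
    have hz' := coord_spec z'
    have hzz : (((coord z).1 : 𝓞 K) + (coord z).2.1 * θint + (coord z).2.2 * ωint) +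
        (((coord z').1 : 𝓞 K) + (coord z').2.1 * θint + (coord z').2.2 * ωint) =
        (((coord z).1 + (coord z').1 : ℤ) : 𝓞 K) + (((coord z).2.1 + (coord z').2.1 : ℤ) : 𝓞 K) * θint +
          (((coord z).2.2 + (coord z').2.2 : ℤ) : 𝓞 K) * ωint := by
      push_cast; ring
    rw [← hz, ← hz'] at hzz
    rw [coord_eq_of_eq hzz]
    push_cast; ring
  map_mul' z z' := by
    have hz := coord_spec z
    have hz' := coord_spec z'
    have hzz := mul_coords (coord z).1 (coord z).2.1 (coord z).2.2 (coord z').1 (coord z').2.1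
      (coord z').2.2
    rw [← hz, ← hz'] at hzz
    rw [coord_eq_of_eq hzz]
    push_cast
    linear_combination (-((coord z).2.1 : S) * (coord z').2.1) * h1 +
      (-(((coord z).2.1 : S) * (coord z').2.2 + (coord z).2.2 * (coord z').2.1)) * h2 +
      (-((coord z).2.2 : S) * (coord z').2.2) * h3

/-- `ringHomOfImages` sends `θ ↦ t`. [folklore] -/
theorem ringHomOfImages_θint {S : Type*} [CommRing S] (t w : S) (h1 : t ^ 2 = 1 + 3 * w)
    (h2 : t * w = 20 + 11 * t - w) (h3 : w ^ 2 = -3 + 3 * t + 11 * w) :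
    ringHomOfImages t w h1 h2 h3 θint = t := by
  show ((coord θint).1 : S) + (coord θint).2.1 * t + (coord θint).2.2 * w = t
  rw [coord_eq_of_eq (z := θint) (a := 0) (b := 1) (c := 0) (by push_cast; ring)]
  push_cast; ring

/-- `ringHomOfImages` sends `ω ↦ w`. [folklore] -/
theorem ringHomOfImages_ωint {S : Type*} [CommRing S] (t w : S) (h1 : t ^ 2 = 1 + 3 * w)
    (h2 : t * w = 20 + 11 * t - w) (h3 : w ^ 2 = -3 + 3 * t + 11 * w) :
    ringHomOfImages t w h1 h2 h3 ωint = w := by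
  show ((coord ωint).1 : S) + (coord ωint).2.1 * t + (coord ωint).2.2 * w = w
  rw [coord_eq_of_eq (z := ωint) (a := 0) (b := 0) (c := 1) (by push_cast; ring)]
  push_cast; ring

/-- **Residue and reduction maps by images**: for `t, w ∈ S` satisfying the relations there is a ring
homomorphism `ψ : 𝓞 K → S` with `ψ θ = t`, `ψ ω = w`. [folklore] -/
theorem exists_ringHom_apply {S : Type*} [CommRing S] (t w : S) (h1 : t ^ 2 = 1 + 3 * w)
    (h2 : t * w = 20 + 11 * t - w) (h3 : w ^ 2 = -3 + 3 * t + 11 * w) :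
    ∃ ψ : 𝓞 K →+* S, ψ θint = t ∧ ψ ωint = w :=
  ⟨ringHomOfImages t w h1 h2 h3, ringHomOfImages_θint t w h1 h2 h3, ringHomOfImages_ωint t w h1 h2 h3⟩

/-! ### The conductor of `θ` contains `3`: Dedekind–Kummer at `p ≠ 3` -/

/-- `3 ∈ 𝔣_θ`: `3 · 𝓞 K ⊆ ℤ[θ]` (`3(a + bθ + cω) = 3a + 3bθ + c(θ² - 1)`). [folklore] -/
theorem three_mem_conductor : (3 : 𝓞 K) ∈ conductor ℤ θint := by
  rw [mem_conductor_iff]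
  intro z
  obtain ⟨a, b, c, rfl⟩ := exists_int_coords z
  have h : (3 : 𝓞 K) * (a + b * θint + c * ωint) = (3 * a - c : ℤ) + (3 * b : ℤ) * θint + c * θint ^ 2 := by
    rw [int_basis_rel.1]; push_cast; ring
  rw [h]
  refine Subalgebra.add_mem _ (Subalgebra.add_mem _ (Subalgebra.intCast_mem _ _)
    (Subalgebra.mul_mem _ (Subalgebra.intCast_mem _ _) (Algebra.self_mem_adjoin_singleton ℤ _))) ?_
  exact Subalgebra.mul_mem _ (Subalgebra.intCast_mem _ _)
    (Subalgebra.pow_mem _ (Algebra.self_mem_adjoin_singleton ℤ _) 2)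

/-- **`p ∤ exponent(θ)` for every prime `p ≠ 3`** (the exponent is the least positive integer in
`𝔣_θ`, hence `≤ 3`; it is not `2`, for then `1 = 3 - 2 ∈ 𝔣_θ`). [folklore] -/
theorem not_dvd_exponent {p : ℕ} (hp : p.Prime) (hp3 : p ≠ 3) : ¬ p ∣ RingOfIntegers.exponent θint := by
  have hset3 : 3 ∈ {d : ℕ | 0 < d ∧ (d : 𝓞 K) ∈ conductor ℤ θint} := ⟨by norm_num, by exact_mod_cast three_mem_conductor⟩
  have hne : {d : ℕ | 0 < d ∧ (d : 𝓞 K) ∈ conductor ℤ θint}.Nonempty := ⟨3, hset3⟩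
  have hle : RingOfIntegers.exponent θint ≤ 3 := by
    rw [RingOfIntegers.exponent_eq_sInf]; exact Nat.sInf_le hset3
  have hmem : RingOfIntegers.exponent θint ∈ {d : ℕ | 0 < d ∧ (d : 𝓞 K) ∈ conductor ℤ θint} := by
    rw [RingOfIntegers.exponent_eq_sInf]; exact Nat.sInf_mem hne
  have hpos : 0 < RingOfIntegers.exponent θint := hmem.1
  have hne2 : RingOfIntegers.exponent θint ≠ 2 := by
    intro h2
    have h2mem : (2 : 𝓞 K) ∈ conductor ℤ θint := by have := hmem.2; rw [h2] at this; exact_mod_cast this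
    have h1mem : (1 : 𝓞 K) ∈ conductor ℤ θint := by
      have := Ideal.sub_mem _ three_mem_conductor h2mem
      norm_num at this
      exact this
    have h1set : 1 ∈ {d : ℕ | 0 < d ∧ (d : 𝓞 K) ∈ conductor ℤ θint} := ⟨by norm_num, by exact_mod_cast h1mem⟩
    have : RingOfIntegers.exponent θint ≤ 1 := by
      rw [RingOfIntegers.exponent_eq_sInf]; exact Nat.sInf_le h1set
    omega
  intro hdvd
  have hple : p ≤ RingOfIntegers.exponent θint := Nat.le_of_dvd hpos hdvd
  have hp2 : 2 ≤ p := hp.two_le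
  interval_cases h : RingOfIntegers.exponent θint
  · omega
  · exact hne2 rfl
  · have : p = 3 := by
      have h3 : p ∣ 3 := hdvd
      exact (Nat.prime_dvd_prime_iff_eq hp Nat.prime_three).mp h3
    exact hp3 this

/-- The reduction of `f` modulo `p`. [folklore] -/
def cubicPolyMod (p : ℕ) : (ZMod p)[X] := cubicPoly.map (Int.castRingHom (ZMod p))

/-- `f mod p` is monic. [folklore] -/
theorem monic_cubicPolyMod (p : ℕ) [Fact p.Prime] : (cubicPolyMod p).Monic := cubicPoly_monic.map _

/-- `f mod p` has degree `3`. [folklore] -/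
theorem natDegree_cubicPolyMod (p : ℕ) [Fact p.Prime] : (cubicPolyMod p).natDegree = 3 := by
  rw [cubicPolyMod, cubicPoly_monic.natDegree_map, cubicPoly_natDegree]

/-- Evaluation of `f mod p`. [folklore] -/
theorem eval_cubicPolyMod (p : ℕ) (c : ZMod p) : (cubicPolyMod p).eval c = c ^ 3 + c ^ 2 - 34 * c - 61 := by
  simp [cubicPolyMod, cubicPoly]

/-- `minpoly_ℤ θint = f`. [folklore] -/
theorem minpoly_θint : minpoly ℤ θint = cubicPoly := by
  rw [← RingOfIntegers.minpoly_coe, coe_θint]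
  convert minpoly_int_θ
  exact Subsingleton.elim _ _

/-- `θint` is a root of `f` in `𝓞 K`. [folklore] -/
theorem aeval_θint : aeval θint cubicPoly = 0 := by
  apply IsFractionRing.injective (𝓞 K) K
  rw [map_zero, ← aeval_algebraMap_apply]
  exact aeval_θ_cubicPoly

/-- **Dedekind–Kummer at `p ≠ 3`**: a prime `P` of `𝓞 K` above `p` is `(p, Q(θ))` for any integer
lift `Q` of the corresponding monic irreducible factor of `f mod p`, of residue degree its degree.
[folklore] -/
theorem exists_factor_of_mem_primesOver {p : ℕ} (hp : p.Prime) (hp3 : p ≠ 3) {P : Ideal (𝓞 K)}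
    (hP : P ∈ primesOver (span {(p : ℤ)}) (𝓞 K)) :
    ∃ Qb : (ZMod p)[X], Irreducible Qb ∧ Qb.Monic ∧ Qb ∣ cubicPolyMod p ∧
      P.inertiaDeg ℤ = Qb.natDegree ∧
      ∀ Q : ℤ[X], Q.map (Int.castRingHom (ZMod p)) = Qb → P = span {(p : 𝓞 K), aeval θint Q} := by
  haveI := Fact.mk hp
  have hexp : ¬ p ∣ RingOfIntegers.exponent θint := not_dvd_exponent hp hp3
  set e := NumberField.Ideal.primesOverSpanEquivMonicFactorsMod (K := K) hexp with he
  set Qb := e ⟨P, hP⟩ with hQb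
  have hmem : (Qb : (ZMod p)[X]) ∈ RingOfIntegers.monicFactorsMod θint p := Qb.2
  have hmem' := hmem
  simp only [RingOfIntegers.monicFactorsMod, Multiset.mem_toFinset, minpoly_θint] at hmem'
  have h0 : cubicPolyMod p ≠ 0 := (monic_cubicPolyMod p).ne_zero
  obtain ⟨hirr, hmon, hdvd⟩ := (Polynomial.mem_normalizedFactors_iff h0).mp hmem'
  refine ⟨Qb, hirr, hmon, hdvd, ?_, ?_⟩
  · have := NumberField.Ideal.inertiaDeg_primesOverSpanEquivMonicFactorsMod_symm_apply' hexp hmem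
    rwa [show (⟨(Qb : (ZMod p)[X]), hmem⟩ : RingOfIntegers.monicFactorsMod θint p) = Qb
      from Subtype.ext rfl, Equiv.symm_apply_apply] at this
  · intro Q hQ
    have hmemQ : Q.map (Int.castRingHom (ZMod p)) ∈ RingOfIntegers.monicFactorsMod θint p := hQ ▸ hmem
    have h1 := NumberField.Ideal.primesOverSpanEquivMonicFactorsMod_symm_apply_eq_span hexp hmemQ
    have h2 : (⟨Q.map (Int.castRingHom (ZMod p)), hmemQ⟩ :
        RingOfIntegers.monicFactorsMod θint p) = Qb := Subtype.ext hQ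
    rw [h2, hQb, Equiv.symm_apply_apply] at h1
    exact h1

/-- **Inert primes**: if `p ≠ 3` and `f` has no root modulo `p`, every prime above `p` is `(p)`, of
residue degree `3`. [folklore] -/
theorem eq_span_of_no_root {p : ℕ} (hp : p.Prime) (hp3 : p ≠ 3) {P : Ideal (𝓞 K)}
    (hP : P ∈ primesOver (span {(p : ℤ)}) (𝓞 K))
    (hnr : ∀ c : ZMod p, c ^ 3 + c ^ 2 - 34 * c - 61 ≠ 0) :
    P = span {(p : 𝓞 K)} ∧ P.inertiaDeg ℤ = 3 := by
  haveI := Fact.mk hp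
  obtain ⟨Qb, hirr, hmon, hdvd, hdeg, hspan⟩ := exists_factor_of_mem_primesOver hp hp3 hP
  have hfirr : Irreducible (cubicPolyMod p) := by
    refine irreducible_of_degree_le_three_of_not_isRoot
      (by rw [natDegree_cubicPolyMod]; decide) fun c hc => hnr c ?_
    rwa [IsRoot.def, eval_cubicPolyMod] at hc
  have hQb : Qb = cubicPolyMod p :=
    eq_of_monic_of_associated hmon (monic_cubicPolyMod p) (hirr.associated_of_dvd hfirr hdvd)
  refine ⟨?_, by rw [hdeg, hQb, natDegree_cubicPolyMod]⟩
  have h := hspan cubicPoly (by rw [hQb]; rfl)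
  rw [aeval_θint] at h
  rw [h, Ideal.span_insert, Ideal.span_singleton_eq_bot.mpr rfl, sup_bot_eq]

/-- `f` has no root modulo `2, 5, 7, 11, 17, 19` (these primes are inert). [folklore] -/
theorem no_root :
    (∀ c : ZMod 2, c ^ 3 + c ^ 2 - 34 * c - 61 ≠ 0) ∧ (∀ c : ZMod 5, c ^ 3 + c ^ 2 - 34 * c - 61 ≠ 0) ∧
    (∀ c : ZMod 7, c ^ 3 + c ^ 2 - 34 * c - 61 ≠ 0) ∧ (∀ c : ZMod 11, c ^ 3 + c ^ 2 - 34 * c - 61 ≠ 0) ∧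
    (∀ c : ZMod 17, c ^ 3 + c ^ 2 - 34 * c - 61 ≠ 0) ∧ (∀ c : ZMod 19, c ^ 3 + c ^ 2 - 34 * c - 61 ≠ 0) := by
  refine ⟨by decide, by decide, by decide, by decide, by decide, by decide⟩

/-- **The inert primes `p = 2, 5, 7, 11, 17, 19`**: `(p)` is prime of residue degree `3` and is the
only prime above `p`. [folklore] -/
theorem span_inert {p : ℕ} (hp : p = 2 ∨ p = 5 ∨ p = 7 ∨ p = 11 ∨ p = 17 ∨ p = 19) :
    (span {(p : 𝓞 K)}).IsPrime ∧ (span {(p : 𝓞 K)}).inertiaDeg ℤ = 3 ∧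
      ∀ P ∈ primesOver (span {(p : ℤ)}) (𝓞 K), P = span {(p : 𝓞 K)} := by
  have hprime : p.Prime := by rcases hp with rfl | rfl | rfl | rfl | rfl | rfl <;> norm_num
  have hp3 : p ≠ 3 := by rcases hp with rfl | rfl | rfl | rfl | rfl | rfl <;> norm_num
  have hnr : ∀ c : ZMod p, c ^ 3 + c ^ 2 - 34 * c - 61 ≠ 0 := by
    obtain ⟨n2, n5, n7, n11, n17, n19⟩ := no_root
    rcases hp with rfl | rfl | rfl | rfl | rfl | rfl
    exacts [n2, n5, n7, n11, n17, n19]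
  have hall : ∀ P ∈ primesOver (span {(p : ℤ)}) (𝓞 K), P = span {(p : 𝓞 K)} ∧ P.inertiaDeg ℤ = 3 :=
    fun P hP => eq_span_of_no_root hprime hp3 hP hnr
  haveI : Fact (Nat.Prime p) := ⟨hprime⟩
  haveI : (span {(p : ℤ)}).IsPrime := (Int.ideal_span_isMaximal_of_prime p).isPrime
  obtain ⟨⟨P, hP⟩⟩ := Ideal.nonempty_primesOver (S := 𝓞 K) (span {(p : ℤ)})
  obtain ⟨hPeq, hdeg⟩ := hall P hP
  subst hPeq
  exact ⟨hP.1, hdeg, fun Q hQ => (hall Q hQ).1⟩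

/-! ### The discriminant `d_K = 103²` from the integral basis `1, θ, ω` -/

/-- The integral basis as a family. [folklore] -/
def intFamily : Fin 3 → 𝓞 K := ![1, θint, ωint]

/-- `1, θ, ω` are linearly independent over `ℤ`. [folklore] -/
theorem linearIndependent_intFamily : LinearIndependent ℤ intFamily := by
  rw [Fintype.linearIndependent_iff]
  intro g hg i
  have h0 : ((g 0 : 𝓞 K) + g 1 * θint + g 2 * ωint : 𝓞 K) = (0 : ℤ) + (0 : ℤ) * θint + (0 : ℤ) * ωint := by
    rw [Fin.sum_univ_three] at hg
    simp only [intFamily, Matrix.cons_val_zero, Matrix.cons_val_one, Matrix.cons_val_two,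
      Matrix.tail_cons, Matrix.head_cons, zsmul_eq_mul] at hg
    push_cast
    linear_combination hg
  have h2 := congrArg (fun x : 𝓞 K => (x : K)) h0
  simp only [map_add, map_mul, map_intCast, coe_θint, coe_ωint] at h2
  obtain ⟨ha, hb, hc⟩ := coords_unique h2
  fin_cases i
  exacts [ha, hb, hc]

/-- `1, θ, ω` span `𝓞 K` over `ℤ`. [folklore] -/
theorem span_intFamily : ⊤ ≤ Submodule.span ℤ (Set.range intFamily) := by
  intro z _
  obtain ⟨a, b, c, rfl⟩ := exists_int_coords z
  have h0 : (1 : 𝓞 K) ∈ Submodule.span ℤ (Set.range intFamily) := Submodule.subset_span ⟨0, rfl⟩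
  have h1 : (θint : 𝓞 K) ∈ Submodule.span ℤ (Set.range intFamily) := Submodule.subset_span ⟨1, rfl⟩
  have h2 : (ωint : 𝓞 K) ∈ Submodule.span ℤ (Set.range intFamily) := Submodule.subset_span ⟨2, rfl⟩
  have e : (a : 𝓞 K) + b * θint + c * ωint = a • (1 : 𝓞 K) + b • θint + c • ωint := by
    simp only [zsmul_eq_mul, mul_one]
  rw [e]
  exact Submodule.add_mem _ (Submodule.add_mem _ (Submodule.smul_mem _ _ h0)
    (Submodule.smul_mem _ _ h1)) (Submodule.smul_mem _ _ h2)

/-- **The integral basis `1, θ, ω` of `𝓞 K`** as a `ℤ`-basis. [folklore] -/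
def intBasis : Module.Basis (Fin 3) ℤ (𝓞 K) := Module.Basis.mk linearIndependent_intFamily span_intFamily

/-- The elements of `intBasis` in `K`: `1, θ, ω`. [folklore] -/
theorem intBasis_apply_coe (i : Fin 3) : ((intBasis i : 𝓞 K) : K) = ![(1 : K), θ, ω] i := by
  rw [intBasis, Module.Basis.mk_apply]
  fin_cases i <;> simp [intFamily]

/-- The change of basis from `1, θ, θ²` to `1, θ, ω` (determinant `1/3`). [folklore] -/
def changeMatrix : Matrix (Fin 3) (Fin 3) ℚ := !![1, 0, -1/3; 0, 1, 0; 0, 0, 1/3]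

/-- `det changeMatrix = 1/3`. [folklore] -/
theorem det_changeMatrix : changeMatrix.det = 1 / 3 := by
  simp [changeMatrix, Matrix.det_fin_three]

/-- `(1, θ, ω) = (1, θ, θ²) · P`. [folklore] -/
theorem vecMul_changeMatrix :
    Matrix.vecMul (fun i : Fin 3 => pbθ.basis ((finCongr pbθ_dim).symm i))
      (changeMatrix.map (algebraMap ℚ K)) = ![(1 : K), θ, ω] := by
  have hb : ∀ i : Fin 3, pbθ.basis ((finCongr pbθ_dim).symm i) = θ ^ (i : ℕ) := fun i => by
    rw [PowerBasis.coe_basis, pbθ_gen]; rfl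
  ext j
  simp only [Matrix.vecMul, dotProduct, Fin.sum_univ_three, Matrix.map_apply, hb]
  fin_cases j <;> simp [changeMatrix, show ω = (θ ^ 2 - 1) / 3 from rfl]
  ring

/-- **`d_K = 10609 = 103²`.** [folklore] -/
theorem discr_eq : NumberField.discr K = 10609 := by
  classical
  apply (algebraMap ℤ ℚ).injective_int
  rw [← NumberField.discr_eq_discr _ intBasis, ← Algebra.discr_localizationLocalization ℤ
    (nonZeroDivisors ℤ) K]
  have hfam : ⇑(intBasis.localizationLocalization ℚ (nonZeroDivisors ℤ) K) = ![(1 : K), θ, ω] := by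
    ext i
    rw [Module.Basis.localizationLocalization_apply, ← intBasis_apply_coe]
  rw [hfam, ← vecMul_changeMatrix, Algebra.discr_of_matrix_vecMul, det_changeMatrix]
  have hre : Algebra.discr ℚ (fun i : Fin 3 => pbθ.basis ((finCongr pbθ_dim).symm i)) =
      Algebra.discr ℚ pbθ.basis := by
    rw [← Algebra.discr_reindex ℚ pbθ.basis (finCongr pbθ_dim)]
    rfl
  rw [hre, discr_pbθ]
  norm_num

/-! ### The Minkowski bound and class number one -/

/-- **`⌊M_K⌋ ≤ 22`**: `M_K = (4/π)^{r₂} (3!/3³) √10609 ≤ (4/3.14)(6/27)·103 < 23`. [folklore] -/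
theorem floor_minkowskiBound_le :
    ⌊(4 / Real.pi) ^ InfinitePlace.nrComplexPlaces K *
        ((Module.finrank ℚ K).factorial / (Module.finrank ℚ K : ℝ) ^ Module.finrank ℚ K *
          Real.sqrt |(NumberField.discr K : ℝ)|)⌋₊ ≤ 22 := by
  have hc : InfinitePlace.nrComplexPlaces K = 0 := by
    -- three real embeddings: `e₁, e₂, e₃` are distinct, so `r₁ = 3`, `r₂ = 0`
    have h1 := InfinitePlace.card_add_two_mul_card_eq_rank K
    rw [finrank_K] at h1
    have hr : 3 ≤ InfinitePlace.nrRealPlaces K := by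
      classical
      rw [← NumberField.InfinitePlace.card_real_embeddings]
      have hreal : ∀ e : K →+* ℝ, ComplexEmbedding.IsReal ((algebraMap ℝ ℂ).comp e) := fun e => by
        rw [ComplexEmbedding.isReal_iff]
        refine RingHom.ext fun x => ?_
        simp only [ComplexEmbedding.conjugate_coe_eq, RingHom.coe_comp, Function.comp_apply,
          Complex.coe_algebraMap, Complex.conj_ofReal]
      let emb : Fin 3 → {φ : K →+* ℂ // ComplexEmbedding.IsReal φ} :=
        ![⟨_, hreal e₁⟩, ⟨_, hreal e₂⟩, ⟨_, hreal e₃⟩]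
      have hval : ∀ i, (emb i).1 θ = ((![r₁, r₂, r₃] i : ℝ) : ℂ) := by
        intro i; fin_cases i <;> simp [emb]
      have hinj : Function.Injective emb := by
        intro i j hij
        have h := congrArg (fun φ : {φ : K →+* ℂ // ComplexEmbedding.IsReal φ} => φ.1 θ) hij
        simp only [hval, Complex.ofReal_inj] at h
        have h1 := r₁_spec.1; have h2 := r₂_spec.1; have h3 := r₃_spec.1
        simp only [Set.mem_Ioo] at h1 h2 h3
        fin_cases i <;> fin_cases j <;> simp at h ⊢ <;> linarith
      simpa using Fintype.card_le_of_injective emb hinj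
    omega
  have hπ : (3.14 : ℝ) < Real.pi := Real.pi_gt_d2
  have hsqrt : Real.sqrt |(NumberField.discr K : ℝ)| = 103 := by
    rw [discr_eq, show ((10609 : ℤ) : ℝ) = (103 : ℝ) ^ 2 by norm_num, abs_of_nonneg (by positivity),
      Real.sqrt_sq (by norm_num)]
  rw [finrank_K, hsqrt, hc, pow_zero, one_mul]
  have hfac : ((3 : ℕ).factorial : ℝ) = 6 := by norm_num [Nat.factorial]
  rw [hfac]
  refine Nat.le_of_lt_succ ((Nat.floor_lt (by positivity)).mpr ?_)
  norm_num

/-- An identity in `𝓞 K` may be checked in `K`. [folklore] -/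
theorem eq_of_K {x y : 𝓞 K} (h : (x : K) = y) : x = y := RingOfIntegers.coe_injective h

/-- `3 = -(θ + 2)(9 - ω)(ω - θ - 6)` in `K`. [folklore] -/
theorem three_eq_mul_K : (3 : K) = -((θ + 2) * (9 - ω) * (ω - θ - 6)) := by
  have h9 : (9 : K) ≠ 0 := by norm_num
  apply mul_left_cancel₀ h9
  calc (9 : K) * 3 = 27 := by norm_num
    _ = -((θ + 2) * (27 - (θ ^ 2 - 1)) * ((θ ^ 2 - 1) - 3 * θ - 18)) := by
        ring_nf; rw [θ_pow_five, θ_pow_four, θ_pow_three]; ring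
    _ = -((θ + 2) * (27 - 3 * ω) * (3 * ω - 3 * θ - 18)) := by rw [three_mul_ω]
    _ = 9 * -((θ + 2) * (9 - ω) * (ω - θ - 6)) := by ring

/-- **`3 = -(θ + 2)(9 - ω)(ω - θ - 6)` in `𝓞 K`** (the three conjugates of `θ + 2`, each of norm
`-3`: `3` splits completely). [folklore] -/
theorem three_eq_mul : (3 : 𝓞 K) = -((θint + 2) * (9 - ωint) * (ωint - θint - 6)) :=
  eq_of_K (by simp only [map_ofNat, map_neg, map_mul, map_add, map_sub, coe_θint, coe_ωint]; exact three_eq_mul_K)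

/-- `13 = -(6 - θ)(ω - 1)(14 + θ - ω)` in `K`. [folklore] -/
theorem thirteen_eq_mul_K : (13 : K) = -((6 - θ) * (ω - 1) * (14 + θ - ω)) := by
  have h9 : (9 : K) ≠ 0 := by norm_num
  apply mul_left_cancel₀ h9
  calc (9 : K) * 13 = 117 := by norm_num
    _ = -((6 - θ) * ((θ ^ 2 - 1) - 3) * (42 + 3 * θ - (θ ^ 2 - 1))) := by
        ring_nf; rw [θ_pow_five, θ_pow_four, θ_pow_three]; ring
    _ = -((6 - θ) * (3 * ω - 3) * (42 + 3 * θ - 3 * ω)) := by rw [three_mul_ω]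
    _ = 9 * -((6 - θ) * (ω - 1) * (14 + θ - ω)) := by ring

/-- **`13 = -(6 - θ)(ω - 1)(14 + θ - ω)` in `𝓞 K`** (conjugates of `6 - θ`, each of norm `-13`).
[folklore] -/
theorem thirteen_eq_mul : (13 : 𝓞 K) = -((6 - θint) * (ωint - 1) * (14 + θint - ωint)) :=
  eq_of_K (by simp only [map_ofNat, map_neg, map_mul, map_add, map_sub, map_one, coe_θint, coe_ωint]; exact thirteen_eq_mul_K)

/-- **Norms of explicit elements of `𝓞 K`**: if `x = aθ² + bθ + c` in `K` then
`N(x) = norm_quadratic(a, b, c)` as an integer. [folklore] -/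
theorem absNorm_span_singleton_eq {x : 𝓞 K} {a b c : ℚ} (hx : (x : K) = (a : K) * θ ^ 2 + (b : K) * θ + c)
    (n : ℤ) (hn : c * ((34 * a + c) * (35 * a - b + c) - (27 * a + 34 * b) * (b - a))
        - 61 * a * (b * (35 * a - b + c) - (27 * a + 34 * b) * a)
        + (-61 * a + 61 * b) * (b * (b - a) - (34 * a + c) * a) = n) :
    absNorm (span {x}) = n.natAbs := by
  have h := Algebra.coe_norm_int x
  rw [hx, norm_quadratic, hn] at h
  have h' : Algebra.norm ℤ x = n := by exact_mod_cast h
  rw [absNorm_span_singleton, h']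

/-- The factors of `3` have norm `3`: `(θ + 2)`, `(9 - ω)`, `(ω - θ - 6)` are ideals of norm `3`.
[folklore] -/
theorem absNorm_three_factors :
    absNorm (span {(θint + 2 : 𝓞 K)}) = 3 ∧ absNorm (span {(9 - ωint : 𝓞 K)}) = 3 ∧
      absNorm (span {(ωint - θint - 6 : 𝓞 K)}) = 3 := by
  refine ⟨absNorm_span_singleton_eq (a := 0) (b := 1) (c := 2) ?_ (-3) (by norm_num),
    absNorm_span_singleton_eq (a := -1/3) (b := 0) (c := 28/3) ?_ (-3) (by norm_num),
    absNorm_span_singleton_eq (a := 1/3) (b := -1) (c := -19/3) ?_ (-3) (by norm_num)⟩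
  · simp only [map_add, map_ofNat, coe_θint]; push_cast; ring
  · simp only [map_sub, map_ofNat, coe_ωint, show ω = (θ ^ 2 - 1) / 3 from rfl]; push_cast; ring
  · simp only [map_sub, map_ofNat, coe_ωint, coe_θint, show ω = (θ ^ 2 - 1) / 3 from rfl]
    push_cast; ring

/-- The factors of `13` have norm `13`. [folklore] -/
theorem absNorm_thirteen_factors :
    absNorm (span {(6 - θint : 𝓞 K)}) = 13 ∧ absNorm (span {(ωint - 1 : 𝓞 K)}) = 13 ∧
      absNorm (span {(14 + θint - ωint : 𝓞 K)}) = 13 := by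
  refine ⟨absNorm_span_singleton_eq (a := 0) (b := -1) (c := 6) ?_ (-13) (by norm_num),
    absNorm_span_singleton_eq (a := 1/3) (b := 0) (c := -4/3) ?_ (-13) (by norm_num),
    absNorm_span_singleton_eq (a := -1/3) (b := 1) (c := 43/3) ?_ (-13) (by norm_num)⟩
  · simp only [map_sub, map_ofNat, coe_θint]; push_cast; ring
  · simp only [map_sub, map_one, coe_ωint, show ω = (θ ^ 2 - 1) / 3 from rfl]; push_cast; ring
  · simp only [map_sub, map_add, map_ofNat, coe_ωint, coe_θint, show ω = (θ ^ 2 - 1) / 3 from rfl]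
    push_cast; ring

/-- A principal ideal of prime norm is a maximal ideal. [folklore] -/
theorem isMaximal_span_of_absNorm {x : 𝓞 K} {q : ℕ} (hq : q.Prime) (h : absNorm (span {x}) = q) :
    (span {x} : Ideal (𝓞 K)).IsMaximal := by
  have hprime : (span {x} : Ideal (𝓞 K)).IsPrime :=
    Ideal.isPrime_of_irreducible_absNorm (by rw [h]; exact hq)
  refine hprime.isMaximal ?_
  intro h0
  rw [h0, Ideal.absNorm_bot] at h
  exact hq.ne_zero h.symm

/-- **A prime containing a product of three generators of maximal ideals is one of them.**
[folklore] -/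
theorem eq_span_of_mem_of_eq_mul {P : Ideal (𝓞 K)} [hP : P.IsPrime] {n : 𝓞 K} {x y z : 𝓞 K}
    (hn : n ∈ P) (he : n = -(x * y * z)) (hx : (span {x} : Ideal (𝓞 K)).IsMaximal)
    (hy : (span {y} : Ideal (𝓞 K)).IsMaximal) (hz : (span {z} : Ideal (𝓞 K)).IsMaximal) :
    P = span {x} ∨ P = span {y} ∨ P = span {z} := by
  rw [he, Ideal.neg_mem_iff] at hn
  have key : ∀ {w : 𝓞 K}, w ∈ P → (span {w} : Ideal (𝓞 K)).IsMaximal → P = span {w} :=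
    fun hw hmax => (hmax.eq_of_le hP.ne_top ((span_singleton_le_iff_mem _).mpr hw)).symm
  rcases hP.mem_or_mem hn with hxy | hz'
  · rcases hP.mem_or_mem hxy with hx' | hy'
    · exact Or.inl (key hx' hx)
    · exact Or.inr (Or.inl (key hy' hy))
  · exact Or.inr (Or.inr (key hz' hz))

/-- **The primes above `3`**: every prime of `𝓞 K` containing `3` is `(θ + 2)`, `(9 - ω)` or
`(ω - θ - 6)`. [folklore] -/
theorem eq_of_three_mem {P : Ideal (𝓞 K)} [P.IsPrime] (h3 : (3 : 𝓞 K) ∈ P) :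
    P = span {(θint + 2 : 𝓞 K)} ∨ P = span {(9 - ωint : 𝓞 K)} ∨ P = span {(ωint - θint - 6 : 𝓞 K)} := by
  obtain ⟨n1, n2, n3⟩ := absNorm_three_factors
  exact eq_span_of_mem_of_eq_mul h3 three_eq_mul (isMaximal_span_of_absNorm Nat.prime_three n1)
    (isMaximal_span_of_absNorm Nat.prime_three n2) (isMaximal_span_of_absNorm Nat.prime_three n3)

/-- **The primes above `13`**: every prime containing `13` is `(6 - θ)`, `(ω - 1)` or
`(14 + θ - ω)`. [folklore] -/
theorem eq_of_thirteen_mem {P : Ideal (𝓞 K)} [P.IsPrime] (h13 : (13 : 𝓞 K) ∈ P) :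
    P = span {(6 - θint : 𝓞 K)} ∨ P = span {(ωint - 1 : 𝓞 K)} ∨ P = span {(14 + θint - ωint : 𝓞 K)} := by
  have hp : Nat.Prime 13 := by norm_num
  obtain ⟨n1, n2, n3⟩ := absNorm_thirteen_factors
  exact eq_span_of_mem_of_eq_mul h13 thirteen_eq_mul (isMaximal_span_of_absNorm hp n1)
    (isMaximal_span_of_absNorm hp n2) (isMaximal_span_of_absNorm hp n3)

/-- A prime of `𝓞 K` above the rational prime `p` contains `p`. [folklore] -/
theorem natCast_mem_of_mem_primesOver {p : ℕ} {P : Ideal (𝓞 K)}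
    (hP : P ∈ primesOver (span {(p : ℤ)}) (𝓞 K)) : (p : 𝓞 K) ∈ P := by
  have h : ((p : ℤ) : 𝓞 K) ∈ P := by
    have hu : (p : ℤ) ∈ P.under ℤ := by rw [← hP.2.over]; exact Ideal.mem_span_singleton_self _
    exact hu
  simpa using h

/-- **`𝓞 K` is a principal ideal domain** (class number one of the cyclic cubic field of conductor
`103`): every ideal class contains a prime above some `p ≤ 22`; the primes `2, 5, 7, 11, 17, 19`
are inert and the primes above `3`, `13` are principal. [folklore] -/
instance instIsPrincipalIdealRing : IsPrincipalIdealRing (𝓞 K) := by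
  refine RingOfIntegers.isPrincipalIdealRing_of_isPrincipal_of_pow_le_of_mem_primesOver_of_mem_Icc
    fun p hp hprime P hP hle => ?_
  have hpU : p ≤ 22 := (Finset.mem_Icc.mp hp).2.trans floor_minkowskiBound_le
  have h1p : 1 ≤ p := (Finset.mem_Icc.mp hp).1
  haveI := hP.1
  have principal_of_eq : ∀ {x : 𝓞 K}, P = span {x} → Submodule.IsPrincipal P := fun h =>
    ⟨⟨_, by rw [h, submodule_span_eq]⟩⟩
  interval_cases p
  all_goals first
    | (exfalso; revert hprime; decide)
    | exact principal_of_eq (eq_span_of_no_root hprime (by norm_num) hP no_root.1).1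
    | exact principal_of_eq (eq_span_of_no_root hprime (by norm_num) hP no_root.2.1).1
    | exact principal_of_eq (eq_span_of_no_root hprime (by norm_num) hP no_root.2.2.1).1
    | exact principal_of_eq (eq_span_of_no_root hprime (by norm_num) hP no_root.2.2.2.1).1
    | exact principal_of_eq (eq_span_of_no_root hprime (by norm_num) hP no_root.2.2.2.2.1).1
    | exact principal_of_eq (eq_span_of_no_root hprime (by norm_num) hP no_root.2.2.2.2.2).1
    | (rcases eq_of_three_mem (natCast_mem_of_mem_primesOver hP) with h | h | h <;>
        exact principal_of_eq h)
    | (rcases eq_of_thirteen_mem (natCast_mem_of_mem_primesOver hP) with h | h | h <;>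
        exact principal_of_eq h)

/-- Every ideal of `𝓞 K` is principal. [folklore] -/
theorem exists_eq_span_singleton (I : Ideal (𝓞 K)) : ∃ β : 𝓞 K, I = span {β} :=
  ⟨_, (IsPrincipalIdealRing.principal I).span_singleton_generator.symm⟩

/-! ### Residue maps at the primes above `3`, and the reduction map to `𝓞 K/8 = (ℤ/8)[t]/(f)` -/

/-- **Residue maps at the primes above `3`**: for every prime `P ∋ 3` of `𝓞 K` there is a ring
homomorphism `𝓞 K → ℤ/3` with kernel `P` (`θ, ω ↦ (1, 2), (2, 0), (2, 2)` at
`(θ + 2), (9 - ω), (ω - θ - 6)`); in particular the residue field is `𝔽₃`. [folklore] -/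
theorem exists_residueMap_of_three_mem {P : Ideal (𝓞 K)} [hP : P.IsPrime] (h3 : (3 : 𝓞 K) ∈ P) :
    ∃ ψ : 𝓞 K →+* ZMod 3, RingHom.ker ψ = P := by
  obtain ⟨n1, n2, n3⟩ := absNorm_three_factors
  have key : ∀ (t w : ZMod 3) (h1 : t ^ 2 = 1 + 3 * w) (h2 : t * w = 20 + 11 * t - w)
      (h3' : w ^ 2 = -3 + 3 * t + 11 * w) (x : 𝓞 K),
      (span {x} : Ideal (𝓞 K)).IsMaximal → ringHomOfImages t w h1 h2 h3' x = 0 →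
      RingHom.ker (ringHomOfImages t w h1 h2 h3') = span {x} := by
    intro t w h1 h2 h3' x hmax hx
    refine (hmax.eq_of_le (RingHom.ker_ne_top _) ?_).symm
    rw [span_singleton_le_iff_mem, RingHom.mem_ker]
    exact hx
  rcases eq_of_three_mem h3 with rfl | rfl | rfl
  · refine ⟨ringHomOfImages 1 2 (by decide) (by decide) (by decide), key 1 2 _ _ _ _
      (isMaximal_span_of_absNorm Nat.prime_three n1) ?_⟩
    rw [map_add, ringHomOfImages_θint, map_ofNat]; decide
  · refine ⟨ringHomOfImages 2 0 (by decide) (by decide) (by decide), key 2 0 _ _ _ _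
      (isMaximal_span_of_absNorm Nat.prime_three n2) ?_⟩
    rw [map_sub, ringHomOfImages_ωint, map_ofNat]; decide
  · refine ⟨ringHomOfImages 2 2 (by decide) (by decide) (by decide), key 2 2 _ _ _ _
      (isMaximal_span_of_absNorm Nat.prime_three n3) ?_⟩
    rw [map_sub, map_sub, ringHomOfImages_ωint, ringHomOfImages_θint, map_ofNat]; decide

/-- **The ring `𝓞 K/8`** as the tree's computable `CubicRing (ZMod 8) 61 34 (-1)`
(`= (ℤ/8)[t]/(t³ + t² - 34t - 61)`; the index `[𝓞 K : ℤ[θ]] = 3` is prime to `8`, and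
`ω = (θ² - 1)/3 ↦ 3(t² - 1)`). [folklore] -/
abbrev O8 : Type := CubicRing (ZMod 8) 61 34 (-1)

/-- The image `t` of `θ` in `𝓞 K/8`. [folklore] -/
def t8 : O8 := ⟨0, 1, 0⟩

/-- The image `w = 3(t² - 1) = ⟨5, 0, 3⟩` of `ω` in `𝓞 K/8`. [folklore] -/
def w8 : O8 := ⟨5, 0, 3⟩

/-- The integral-basis relations hold for `t8, w8` (by computation). [folklore] -/
theorem rel8 : t8 ^ 2 = 1 + 3 * w8 ∧ t8 * w8 = 20 + 11 * t8 - w8 ∧ w8 ^ 2 = -3 + 3 * t8 + 11 * w8 := by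
  refine ⟨by decide, by decide, by decide⟩

/-- **The reduction map `ψ₈ : 𝓞 K → 𝓞 K/8 = (ℤ/8)[t]/(f)`**, `θ ↦ t`, `ω ↦ 3(t² - 1)`. [folklore] -/
theorem exists_ψ₈ : ∃ ψ : 𝓞 K →+* O8, ψ θint = t8 ∧ ψ ωint = w8 :=
  exists_ringHom_apply t8 w8 rel8.1 rel8.2.1 rel8.2.2

end CyclicCubic103

end Literature.NumberTheory.NumberFields

end
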